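import Literature.Barriers.QuantumFields.UnitaryHaarSmallBall
import HarnessLib

/-!
# Gauge-boot: the UPPER small-ball bound for Haar measure on `U(N)` —
# `μ{V : ‖V − 1‖_op ≤ ρ} ≤ (10ρ)^{N²}` (supplement 21, part 3a)

HONEST FRAMING (cell `pub-gaugeboot`, page 1 of every file): certified bounds on lattice
expectations at STATED coupling, gauge group, dimension and torus size; NOT a mass gap, NOT a
continuum limit, NOT a string tension, NOT large `N`; NOT Yang–Mills-summit-bearing (barriers
`FixedCouplingUltralocality`, `PerturbativeInvisibility`).  Pure measure theory on a compact group;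
it certifies no number.  Input of the explicit-constant `O(1/β)` bound of parts 3c–3e.

## Content

The tree's `Literature.Barriers.QuantumFields.UnitaryHaarSmallBall` proves the LOWER bound
`μ{‖V − 1‖_op ≤ ρ} ≥ (ρ/(2π+ρ))^{N²}` by a covering argument (every unitary is `e^{iH}`,
`‖H‖ ≤ π`; `H ↦ e^{iH}` is `1`-Lipschitz; nets of `{‖H‖ ≤ π} ⊂ ℝ^{N²}` by volume).  Here is the
matching UPPER bound, by PACKING:

* `HaarPacking.norm_expUnitary_sub_expUnitary_sub_smul_le` — second-order Duhamel in any
  C⋆-algebra: `‖e^{ix} − e^{iy} − i(x − y)‖ ≤ max(‖x‖, ‖y‖) · ‖x − y‖` for self-adjoint `x, y`;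
  hence ★ `HaarPacking.le_norm_expHermUnitary_sub` — on `{‖H‖ ≤ 1/2}` the chart is CO-Lipschitz:
  `‖e^{iH} − e^{iH'}‖ ≥ ½‖H − H'‖`;
* `HaarPacking.le_card_of_net`, `HaarPacking.exists_separated_net` — a `ρ`-net of `{uOpNorm ≤ R}`
  has at least `(R/ρ)^{N²}` points (volume scaling), and maximal `ρ`-separated sets are such nets;
* ★★ `HaarPacking.haar_unitaryOpBall_le` — **for every left-invariant probability measure `μ` on
  `U(N)` and every `ρ > 0`: `μ{V : ‖V − 1‖_op ≤ ρ} ≤ (10ρ)^{N²}`**: the `(1/(10ρ))^{N²}` left translates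
  of the ball by `e^{iH_k}`, `H_k` a `5ρ`-separated family in `{‖H‖ ≤ 1/2}`, are pairwise disjoint.

With the barrier file this pins `μ{‖V − 1‖_op ≤ ρ}` between `(ρ/(2π+1))^{N²}` and `(10ρ)^{N²}` for
`ρ ≤ 1`: Haar measure on `U(N)` is exactly `N²`-dimensional at the identity, with `N`-uniform constants
per dimension and no Weyl formula.  [folklore] (S. Szarek, *Metric entropy of homogeneous spaces*,
Banach Center Publ. 43 (1998); everything is proved from Mathlib and the tree.)
-/

open Complex NormedSpace selfAdjoint Unitary MeasureTheory
open scoped Real Matrix.Norms.L2Operator Pointwise ENNReal NNReal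
open Literature.Barriers.QuantumFields

noncomputable section

namespace Summit.QuantumFields.GaugeBoot

namespace HaarPacking

/-! ### Second-order Duhamel in a C⋆-algebra -/

section General
variable {A : Type*} [CStarAlgebra A]

/-- `‖e^{i t x} − 1‖ ≤ |t| ‖x‖` for self-adjoint `x` (the `1`-Lipschitz bound at `0`). [folklore] -/
lemma norm_exp_smul_sub_one_le (x : selfAdjoint A) (t : ℝ) :
    ‖exp (t • (I • (x : A))) - 1‖ ≤ |t| * ‖(x : A)‖ := by
  have h := norm_expUnitary_sub_expUnitary_le (t • x) 0
  rw [selfAdjoint.expUnitary_zero] at h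
  have h1 : (expUnitary (t • x) : A) = exp (t • (I • (x : A))) := by
    rw [expUnitary_coe, selfAdjoint.val_smul, smul_comm]
  rw [h1] at h
  simp only [OneMemClass.coe_one, ZeroMemClass.coe_zero, sub_zero, selfAdjoint.val_smul, norm_smul,
    Real.norm_eq_abs] at h
  exact h

/-- **Second-order Duhamel bound**: for self-adjoint `x, y` of a C⋆-algebra,
`‖e^{ix} − e^{iy} − i(x − y)‖ ≤ max(‖x‖, ‖y‖) · ‖x − y‖`.  With `G(t) = e^{ita}e^{i(1−t)b} − t(a − b)`
(`a = ix`, `b = iy`): `G' = (e^{ita} − 1)(a − b)e^{i(1−t)b} + (a − b)(e^{i(1−t)b} − 1)`, of norm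
`≤ (t‖x‖ + (1−t)‖y‖)‖x − y‖`, and the mean-value inequality on `[0, 1]`. [folklore] -/
lemma norm_expUnitary_sub_expUnitary_sub_smul_le (x y : selfAdjoint A) :
    ‖((expUnitary x : A) - (expUnitary y : A)) - I • ((x : A) - (y : A))‖ ≤
      max ‖(x : A)‖ ‖(y : A)‖ * ‖(x : A) - (y : A)‖ := by
  nontriviality A
  set a : A := I • (x : A) with ha
  set b : A := I • (y : A) with hb
  set G : ℝ → A := fun t => exp (t • a) * exp ((1 - t) • b) - t • (a - b) with hG
  have hG1 : G 1 = expUnitary x - (a - b) := by simp [hG, ha]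
  have hG0 : G 0 = expUnitary y := by simp [hG, hb]
  have hab : a - b = I • ((x : A) - (y : A)) := by rw [ha, hb, smul_sub]
  have hderiv : ∀ t : ℝ, HasDerivAt G
      (((exp (t • a) * a) * exp ((1 - t) • b) +
        exp (t • a) * ((-1 : ℝ) • (exp ((1 - t) • b) * b))) - (a - b)) t := by
    intro t
    have h1 : HasDerivAt (fun u : ℝ => exp (u • a)) (exp (t • a) * a) t :=
      hasDerivAt_exp_smul_const a t
    have h2 : HasDerivAt (fun u : ℝ => exp ((1 - u) • b))
        ((-1 : ℝ) • (exp ((1 - t) • b) * b)) t := by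
      have hg : HasDerivAt (fun s : ℝ => exp (s • b)) (exp ((1 - t) • b) * b) (1 - t) :=
        hasDerivAt_exp_smul_const b (1 - t)
      have hh : HasDerivAt (fun u : ℝ => 1 - u) (-1 : ℝ) t := by
        simpa using (hasDerivAt_id t).const_sub (1 : ℝ)
      exact hg.scomp t hh
    have h3 : HasDerivAt (fun u : ℝ => u • (a - b)) (a - b) t := by
      simpa using (hasDerivAt_id t).smul_const (a - b)
    exact (h1.mul h2).sub h3
  have hbound : ∀ t ∈ Set.Ico (0 : ℝ) 1,
      ‖((exp (t • a) * a) * exp ((1 - t) • b) +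
          exp (t • a) * ((-1 : ℝ) • (exp ((1 - t) • b) * b))) - (a - b)‖ ≤
        max ‖(x : A)‖ ‖(y : A)‖ * ‖(x : A) - (y : A)‖ := by
    intro t ht
    have hcomm : exp ((1 - t) • b) * b = b * exp ((1 - t) • b) :=
      (((Commute.refl b).smul_left (1 - t)).exp_left).eq
    have hrw : ((exp (t • a) * a) * exp ((1 - t) • b) +
          exp (t • a) * ((-1 : ℝ) • (exp ((1 - t) • b) * b))) - (a - b)
        = (exp (t • a) - 1) * (a - b) * exp ((1 - t) • b) + (a - b) * (exp ((1 - t) • b) - 1) := by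
      rw [hcomm, neg_one_smul]
      noncomm_ring
    rw [hrw]
    have hE : ‖exp ((1 - t) • b)‖ = 1 :=
      CStarRing.norm_of_mem_unitary (exp_real_smul_I_smul_mem_unitary y (1 - t))
    have hnab : ‖a - b‖ = ‖((x : A) - (y : A))‖ := by
      rw [hab, norm_smul, Complex.norm_I, one_mul]
    have h1 : ‖exp (t • a) - 1‖ ≤ t * ‖(x : A)‖ := by
      have := norm_exp_smul_sub_one_le x t
      rwa [abs_of_nonneg ht.1] at this
    have h2 : ‖exp ((1 - t) • b) - 1‖ ≤ (1 - t) * ‖(y : A)‖ := by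
      have := norm_exp_smul_sub_one_le y (1 - t)
      rwa [abs_of_nonneg (by linarith [ht.2] : (0 : ℝ) ≤ 1 - t)] at this
    calc ‖(exp (t • a) - 1) * (a - b) * exp ((1 - t) • b) + (a - b) * (exp ((1 - t) • b) - 1)‖
        ≤ ‖(exp (t • a) - 1) * (a - b) * exp ((1 - t) • b)‖ + ‖(a - b) * (exp ((1 - t) • b) - 1)‖ :=
          norm_add_le _ _
      _ ≤ ‖exp (t • a) - 1‖ * ‖a - b‖ * ‖exp ((1 - t) • b)‖ + ‖a - b‖ * ‖exp ((1 - t) • b) - 1‖ :=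
          add_le_add norm_mul₃_le (norm_mul_le _ _)
      _ ≤ (t * ‖(x : A)‖) * ‖a - b‖ * 1 + ‖a - b‖ * ((1 - t) * ‖(y : A)‖) := by
          rw [hE]; gcongr
      _ = (t * ‖(x : A)‖ + (1 - t) * ‖(y : A)‖) * ‖(x : A) - (y : A)‖ := by rw [hnab]; ring
      _ ≤ max ‖(x : A)‖ ‖(y : A)‖ * ‖(x : A) - (y : A)‖ := by
          refine mul_le_mul_of_nonneg_right ?_ (norm_nonneg _)
          have hx := le_max_left ‖(x : A)‖ ‖(y : A)‖
          have hy := le_max_right ‖(x : A)‖ ‖(y : A)‖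
          nlinarith [ht.1, ht.2]
  have := norm_image_sub_le_of_norm_deriv_le_segment_01' (fun t _ => (hderiv t).hasDerivWithinAt) hbound
  rw [hG1, hG0, hab, sub_right_comm] at this
  exact this

end General

/-! ### The chart `y ↦ e^{i uHerm y}` is co-Lipschitz near `0` -/

section Mat
variable {N : ℕ}

/-- ★ **Co-Lipschitz chart**: for `uOpNorm x, uOpNorm y ≤ 1/2`,
`½ · uOpNorm (x − y) ≤ ‖e^{i uHerm x} − e^{i uHerm y}‖_op`. [folklore] -/
theorem le_norm_expHermUnitary_sub (x y : Fin N × Fin N → ℝ) (hx : uOpNorm x ≤ 1 / 2)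
    (hy : uOpNorm y ≤ 1 / 2) :
    uOpNorm (x - y) / 2 ≤
      ‖(expHermUnitary x : Matrix (Fin N) (Fin N) ℂ) - (expHermUnitary y : Matrix (Fin N) (Fin N) ℂ)‖ := by
  letI : CStarAlgebra (Matrix (Fin N) (Fin N) ℂ) := {}
  have h := norm_expUnitary_sub_expUnitary_sub_smul_le
    (⟨uHerm x, uHerm_isSelfAdjoint x⟩ : selfAdjoint (Matrix (Fin N) (Fin N) ℂ)) ⟨uHerm y, uHerm_isSelfAdjoint y⟩
  simp only at h
  have hxy : ‖uHerm x - uHerm y‖ = uOpNorm (x - y) := by rw [uOpNorm, uHerm_sub]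
  have hmax : max ‖uHerm x‖ ‖uHerm y‖ ≤ 1 / 2 := max_le hx hy
  have hI : ‖I • (uHerm x - uHerm y)‖ = uOpNorm (x - y) := by rw [norm_smul, Complex.norm_I, one_mul, hxy]
  set E := (expHermUnitary x : Matrix (Fin N) (Fin N) ℂ) - (expHermUnitary y : Matrix (Fin N) (Fin N) ℂ)
  have hE : E = (expUnitary ⟨uHerm x, uHerm_isSelfAdjoint x⟩ : Matrix (Fin N) (Fin N) ℂ) -
      (expUnitary ⟨uHerm y, uHerm_isSelfAdjoint y⟩ : Matrix (Fin N) (Fin N) ℂ) := rfl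
  have h2 : ‖E - I • (uHerm x - uHerm y)‖ ≤ 1 / 2 * uOpNorm (x - y) := by
    rw [hE]
    refine h.trans ?_
    rw [hxy]
    exact mul_le_mul_of_nonneg_right hmax (uOpNorm_nonneg _)
  have h3 : ‖I • (uHerm x - uHerm y)‖ ≤ ‖E‖ + ‖E - I • (uHerm x - uHerm y)‖ := by
    have := norm_sub_le E (E - I • (uHerm x - uHerm y))
    rwa [sub_sub_cancel] at this
  rw [hI] at h3
  linarith

/-! ### Nets of `{uOpNorm ≤ R}` are large -/

/-- **Volumetric lower bound for nets**: if every point of `{uOpNorm < R}` is within `uOpNorm`-distance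
`< s` of the finite set `F` (`0 < s`, `0 < R`), then `(R/s)^{N²} ≤ #F`. [folklore] -/
theorem le_card_of_net {R s : ℝ} (hR : 0 < R) (hs : 0 < s) (F : Finset (Fin N × Fin N → ℝ))
    (hnet : ∀ x, uOpNorm x < R → ∃ y ∈ F, uOpNorm (x - y) < s) :
    (R / s) ^ (N * N) ≤ (F.card : ℝ) := by
  set B : (Fin N × Fin N → ℝ) → Set (Fin N × Fin N → ℝ) :=
    fun y => (fun z => z + (-y)) ⁻¹' uOpBall N s with hBdef
  have hBvol : ∀ y, volume (B y) = volume (uOpBall N s) := fun y =>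
    measure_preimage_add_right volume (-y) (uOpBall N s)
  have hcover : uOpBall N R ⊆ ⋃ y ∈ F, B y := by
    intro x hx
    obtain ⟨y, hy, hxy⟩ := hnet x hx
    refine Set.mem_iUnion₂.2 ⟨y, hy, ?_⟩
    simp only [hBdef, Set.mem_preimage, uOpBall, Set.mem_setOf_eq, ← sub_eq_add_neg]
    exact hxy
  set c : ℝ := s / R with hcdef
  have hc : 0 < c := div_pos hs hR
  have hscale : uOpBall N s = c • uOpBall N R := by
    rw [smul_uOpBall hc, hcdef, div_mul_cancel₀ _ hR.ne']
  have hvol : volume (uOpBall N s) = ENNReal.ofReal (c ^ (N * N)) * volume (uOpBall N R) := by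
    rw [hscale, Measure.addHaar_smul_of_nonneg volume hc.le, finrank_uCoordSpace]
  have h1 : volume (uOpBall N R) ≤ (F.card : ℝ≥0∞) * volume (uOpBall N s) := by
    calc volume (uOpBall N R) ≤ volume (⋃ y ∈ F, B y) := measure_mono hcover
      _ ≤ ∑ y ∈ F, volume (B y) := measure_biUnion_finset_le F B
      _ = (F.card : ℝ≥0∞) * volume (uOpBall N s) := by
          rw [Finset.sum_congr rfl (fun y _ => hBvol y), Finset.sum_const, nsmul_eq_mul]
  rw [hvol, ← mul_assoc] at h1
  have hV0 : volume (uOpBall N R) ≠ 0 := (volume_uOpBall_pos hR).ne'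
  have hVt : volume (uOpBall N R) ≠ ⊤ := (volume_uOpBall_lt_top R).ne
  have h2 : 1 ≤ (F.card : ℝ≥0∞) * ENNReal.ofReal (c ^ (N * N)) := by
    have key : 1 * volume (uOpBall N R) ≤ ((F.card : ℝ≥0∞) * ENNReal.ofReal (c ^ (N * N))) * volume (uOpBall N R) := by
      rwa [one_mul]
    exact (ENNReal.mul_le_mul_iff_left hV0 hVt).1 key
  have h3 : (1 : ℝ) ≤ (F.card : ℝ) * c ^ (N * N) := by
    have h' : ENNReal.ofReal 1 ≤ ENNReal.ofReal ((F.card : ℝ) * c ^ (N * N)) := by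
      rw [ENNReal.ofReal_one, ENNReal.ofReal_mul (Nat.cast_nonneg _), ENNReal.ofReal_natCast]
      exact h2
    exact (ENNReal.ofReal_le_ofReal_iff (by positivity)).1 h'
  have hcn : 0 < c ^ (N * N) := pow_pos hc _
  rw [hcdef, div_pow] at h3
  rw [div_pow, div_le_iff₀ (pow_pos hs _)]
  have hRn : 0 < R ^ (N * N) := pow_pos hR _
  rw [mul_div_assoc', one_le_div hRn] at h3
  linarith

/-- **Separated nets.** For `0 < s` and `0 ≤ R` there is a finite `s`-separated subset of
`{uOpNorm ≤ R}` which is an `s`-net of it (a maximal separated set; finite by the tree's packing bound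
`card_le_of_uOpNorm_separated`). [folklore] -/
theorem exists_separated_net {R s : ℝ} (hR : 0 ≤ R) (hs : 0 < s) :
    ∃ F : Finset (Fin N × Fin N → ℝ), (∀ y ∈ F, uOpNorm y ≤ R) ∧
      (∀ x ∈ F, ∀ y ∈ F, x ≠ y → s ≤ uOpNorm (x - y)) ∧
      ∀ x, uOpNorm x ≤ R → ∃ y ∈ F, uOpNorm (x - y) < s := by
  classical
  let good : Finset (Fin N × Fin N → ℝ) → Prop := fun F =>
    (∀ y ∈ F, uOpNorm y ≤ R) ∧ (∀ x ∈ F, ∀ y ∈ F, x ≠ y → s ≤ uOpNorm (x - y))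
  let P : ℕ → Prop := fun k => ∃ F, good F ∧ F.card = k
  set Bd : ℕ := ⌊((2 * R + s) / s) ^ (N * N)⌋₊ with hBd
  have hcard : ∀ F, good F → F.card ≤ Bd := fun F hF =>
    Nat.le_floor (card_le_of_uOpNorm_separated hR hs F hF.1 hF.2)
  have hP0 : P 0 := ⟨∅, ⟨by simp, by simp⟩, rfl⟩
  set k₀ := Nat.findGreatest P Bd with hk₀
  obtain ⟨F₀, hgood, hcardF₀⟩ : P k₀ := Nat.findGreatest_spec (Nat.zero_le Bd) hP0
  refine ⟨F₀, hgood.1, hgood.2, fun x hx => ?_⟩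
  by_contra hcon
  push Not at hcon
  have hxF : x ∉ F₀ := by
    intro hxF
    have := hcon x hxF
    rw [sub_self, uOpNorm_zero] at this
    linarith
  have hgood' : good (insert x F₀) := by
    refine ⟨?_, ?_⟩
    · intro y hy
      rcases Finset.mem_insert.1 hy with rfl | hy
      · exact hx
      · exact hgood.1 y hy
    · intro a ha b hb hab
      rw [Finset.mem_insert] at ha hb
      rcases ha with ha | ha
      · rcases hb with hb | hb
        · exact absurd (ha.trans hb.symm) hab
        · rw [ha]; exact hcon b hb
      · rcases hb with hb | hb
        · rw [hb, uOpNorm_sub_comm]; exact hcon a ha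
        · exact hgood.2 a ha b hb hab
  have hP1 : P (k₀ + 1) :=
    ⟨insert x F₀, hgood', by rw [Finset.card_insert_of_notMem hxF, hcardF₀]⟩
  have hle : k₀ + 1 ≤ Bd := by
    have := hcard _ hgood'
    rwa [Finset.card_insert_of_notMem hxF, hcardF₀] at this
  exact Nat.findGreatest_is_greatest (Nat.lt_succ_self k₀) hle hP1

/-! ### Packing in `U(N)`: the upper small-ball bound -/

/-- `‖W⁻¹U − 1‖ = ‖U − W‖` for unitary matrices (`W⁻¹U − 1 = W⋆(U − W)`). [folklore] -/
theorem norm_inv_mul_sub_one (U W : Matrix.unitaryGroup (Fin N) ℂ) :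
    ‖((W⁻¹ * U : Matrix.unitaryGroup (Fin N) ℂ) : Matrix (Fin N) (Fin N) ℂ) - 1‖ =
      ‖(U : Matrix (Fin N) (Fin N) ℂ) - (W : Matrix (Fin N) (Fin N) ℂ)‖ := by
  letI : CStarAlgebra (Matrix (Fin N) (Fin N) ℂ) := {}
  have hW : (star (W : Matrix (Fin N) (Fin N) ℂ)) * (W : Matrix (Fin N) (Fin N) ℂ) = 1 :=
    Unitary.coe_star_mul_self W
  have : ((W⁻¹ * U : Matrix.unitaryGroup (Fin N) ℂ) : Matrix (Fin N) (Fin N) ℂ) - 1 =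
      star (W : Matrix (Fin N) (Fin N) ℂ) *
        ((U : Matrix (Fin N) (Fin N) ℂ) - (W : Matrix (Fin N) (Fin N) ℂ)) := by
    rw [mul_sub, hW]
    rfl
  rw [this]
  exact CStarRing.norm_mem_unitary_mul _ (Unitary.star_mem W.2)

/-- ★★ **Upper small-ball bound for Haar measure on `U(N)`**: for every left-invariant probability
measure `μ` on `U(N)` and every `ρ > 0`, `μ{V : ‖V − 1‖_op ≤ ρ} ≤ (10ρ)^{N²}`. [folklore] -/
theorem haar_unitaryOpBall_le (μ : Measure (Matrix.unitaryGroup (Fin N) ℂ)) [IsProbabilityMeasure μ]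
    [μ.IsMulLeftInvariant] {ρ : ℝ} (hρ : 0 < ρ) :
    μ (unitaryOpBall N ρ) ≤ ENNReal.ofReal ((10 * ρ) ^ (N * N)) := by
  rcases le_or_gt 1 (10 * ρ) with hbig | hsmall
  · calc μ (unitaryOpBall N ρ) ≤ 1 := prob_le_one
      _ ≤ ENNReal.ofReal ((10 * ρ) ^ (N * N)) := by
          rw [← ENNReal.ofReal_one]; exact ENNReal.ofReal_le_ofReal (one_le_pow₀ hbig)
  -- a `5ρ`-separated net of `{uOpNorm ≤ 1/2}`
  obtain ⟨F, hFR, hsep, hnet⟩ := exists_separated_net (N := N) (R := 1 / 2) (by norm_num)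
    (s := 5 * ρ) (by positivity)
  have hcardF : (1 / (10 * ρ)) ^ (N * N) ≤ (F.card : ℝ) := by
    have h := le_card_of_net (N := N) (R := 1 / 2) (by norm_num) (s := 5 * ρ) (by positivity) F
      (fun x hx => hnet x hx.le)
    rwa [show (1 / 2 : ℝ) / (5 * ρ) = 1 / (10 * ρ) by field_simp; ring] at h
  -- the left translates of the ball by `e^{i uHerm y}`, `y ∈ F`, are pairwise disjoint
  set S : (Fin N × Fin N → ℝ) → Set (Matrix.unitaryGroup (Fin N) ℂ) :=
    fun y => (fun U => (expHermUnitary y)⁻¹ * U) ⁻¹' unitaryOpBall N ρ with hSdef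
  have hSmeas : ∀ y, MeasurableSet (S y) := fun y =>
    (measurableSet_unitaryOpBall ρ).preimage (measurable_const_mul _)
  have hSμ : ∀ y, μ (S y) = μ (unitaryOpBall N ρ) := fun y => measure_preimage_mul μ _ _
  have hdisj : (F : Set (Fin N × Fin N → ℝ)).PairwiseDisjoint S := by
    intro y hy y' hy' hyy'
    rw [Function.onFun, Set.disjoint_left]
    intro U hU hU'
    have h1 : ‖(U : Matrix (Fin N) (Fin N) ℂ) - (expHermUnitary y : Matrix (Fin N) (Fin N) ℂ)‖ ≤ ρ := by
      rw [← norm_inv_mul_sub_one]; exact hU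
    have h2 : ‖(U : Matrix (Fin N) (Fin N) ℂ) - (expHermUnitary y' : Matrix (Fin N) (Fin N) ℂ)‖ ≤ ρ := by
      rw [← norm_inv_mul_sub_one]; exact hU'
    have h3 : ‖(expHermUnitary y : Matrix (Fin N) (Fin N) ℂ) - (expHermUnitary y' : Matrix (Fin N) (Fin N) ℂ)‖
        ≤ 2 * ρ := by
      calc ‖(expHermUnitary y : Matrix (Fin N) (Fin N) ℂ) - (expHermUnitary y' : Matrix (Fin N) (Fin N) ℂ)‖
          ≤ ‖(expHermUnitary y : Matrix (Fin N) (Fin N) ℂ) - U‖ +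
            ‖(U : Matrix (Fin N) (Fin N) ℂ) - (expHermUnitary y' : Matrix (Fin N) (Fin N) ℂ)‖ := norm_sub_le_norm_sub_add_norm_sub _ _ _
        _ ≤ ρ + ρ := add_le_add (by rwa [norm_sub_rev]) h2
        _ = 2 * ρ := by ring
    have h4 := le_norm_expHermUnitary_sub y y' ((hFR y hy).trans (by norm_num)) ((hFR y' hy').trans (by norm_num))
    have h5 := hsep y hy y' hy' hyy'
    linarith
  have hsum : (F.card : ℝ≥0∞) * μ (unitaryOpBall N ρ) ≤ 1 := by
    calc (F.card : ℝ≥0∞) * μ (unitaryOpBall N ρ) = ∑ y ∈ F, μ (S y) := by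
          rw [Finset.sum_congr rfl (fun y _ => hSμ y), Finset.sum_const, nsmul_eq_mul]
      _ = μ (⋃ y ∈ F, S y) := (measure_biUnion_finset hdisj (fun y _ => hSmeas y)).symm
      _ ≤ 1 := prob_le_one
  -- conclude in `ℝ`
  have hfin : μ (unitaryOpBall N ρ) ≠ ⊤ := measure_ne_top μ _
  have hreal : (F.card : ℝ) * μ.real (unitaryOpBall N ρ) ≤ 1 := by
    have h : ENNReal.ofReal ((F.card : ℝ) * μ.real (unitaryOpBall N ρ)) ≤ ENNReal.ofReal 1 := by
      rw [ENNReal.ofReal_mul (Nat.cast_nonneg _), ENNReal.ofReal_natCast, ENNReal.ofReal_one,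
        ofReal_measureReal hfin]
      exact hsum
    exact (ENNReal.ofReal_le_ofReal_iff zero_le_one).1 h
  have hpos : 0 < (1 / (10 * ρ)) ^ (N * N) := by positivity
  have hμle : μ.real (unitaryOpBall N ρ) ≤ (10 * ρ) ^ (N * N) := by
    have h1 : (1 / (10 * ρ)) ^ (N * N) * μ.real (unitaryOpBall N ρ) ≤ 1 :=
      (mul_le_mul_of_nonneg_right hcardF measureReal_nonneg).trans hreal
    rw [div_pow, one_pow, div_mul_eq_mul_div, div_le_one (by positivity), one_mul] at h1
    exact h1
  rw [← ofReal_measureReal hfin]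
  exact ENNReal.ofReal_le_ofReal hμle

/-- **Two-sided**: for `0 < ρ`, `(ρ/(2π+ρ))^{N²} ≤ μ{‖V − 1‖_op ≤ ρ} ≤ (10ρ)^{N²}` (the tree's covering
bound and the packing bound). [folklore] -/
theorem haar_unitaryOpBall_mem_Icc (μ : Measure (Matrix.unitaryGroup (Fin N) ℂ)) [IsProbabilityMeasure μ]
    [μ.IsMulLeftInvariant] {ρ : ℝ} (hρ : 0 < ρ) :
    μ (unitaryOpBall N ρ) ∈ Set.Icc (ENNReal.ofReal ((ρ / (2 * π + ρ)) ^ (N * N)))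
      (ENNReal.ofReal ((10 * ρ) ^ (N * N))) :=
  ⟨haar_unitaryOpBall_ge μ hρ, haar_unitaryOpBall_le μ hρ⟩

end Mat

end HaarPacking

end Summit.QuantumFields.GaugeBoot

end
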